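import Summits.BirchSwinnertonDyer.Rank1Residual.GaloisImage.ThreeCongruenceHesseCertificatesBatch5
import Literature.NumberTheory.EllipticCurves.Fisher2012.HesseFamilyThreeReverseProofs
import Summits.BirchSwinnertonDyer.Rank1Residual.Additive.X4ThreeVisibleRowShape35217b1
import Summits.BirchSwinnertonDyer.Rank1Residual.Additive.X4ThreeVisibleRowShape37152e1
import Summits.BirchSwinnertonDyer.Rank1Residual.Additive.X4ThreeVisibleRowShape37440fm1
import Summits.BirchSwinnertonDyer.Rank1Residual.Additive.X4ThreeVisibleRowShape38025bb1
import Summits.BirchSwinnertonDyer.BirchSwinnertonDyer.Theorems.Rank2ObservatoryKernelCerts1070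
import Summits.BirchSwinnertonDyer.BirchSwinnertonDyer.Theorems.Rank2ObservatoryKernelCerts245
import Summits.BirchSwinnertonDyer.BirchSwinnertonDyer.Theorems.Rank2ObservatoryKernelCertsF92
import Summits.BirchSwinnertonDyer.BirchSwinnertonDyer.Theorems.Rank2ObservatoryKernelCertsT227
import HarnessLib

/-!
# T-VIS3-REC row shapes with the C-VIS `θ/hθ` column AND the rank column DISCHARGED IN THE KERNEL —
# batch `Batch5`: 35217b1, 37152e1, 37440fm1, 38025bb1
# (cell `b2b-bsdres`, team n1011, ROW T-VIS3-TH; seat p07 lineage; skeleton cells/n1011/skel/T-VIS3-TH.md;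
# generated by `tools/gen_twins.py` from the TREE text of the p18-lineage shapes — consumed BY NAME, nothing edited)

HONEST FRAMING (cell `b2b-bsdres`, run/shared/lean/b2b/bsd-rank1-residual/, verbatim in every
file): the goal of the cell is to DELETE the COMBINATION-SHAPED residual classes of the
Birch–Swinnerton-Dyer formula for ALL analytic-rank `≤ 1` elliptic curves over `ℚ` — "full BSD
formula for every rank `≤ 1` curve in class `C`" assembled STRICTLY from published theorems — so
that the rank-`≤ 1` remainder becomes exactly the CONSTRUCTION-SHAPED classes, which are TYPED
(missing-input `Prop`s), NOT attempted. This is not "finishing BSD". Team n1011 (N11 = X4 ∧ `p = 3`):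
research route; RECORD theorems only — NO definition, NO new named fact, NO `sorry`; a record closes
NO class and moves no mark / label / count; nothing booked; census count unchanged.

## What

Same construction as `Additive/X4ThreeVisibleRowShapesThetaFree.lean` (ROW T-VIS3-TH FILE 2): for each row
`bsdp3_visHesse_v<E>` := `bsdp3_vis_v<E>` with `(W') (hW') [W'.IsElliptic] (θ) (hθ)` ↦ the literal partner +
`VisCerts.torsionIso3_<E′>_<E>_of_integralModelInt` (`GaloisImage/ThreeCongruenceHesseCertificatesBatch5`; DUAL pairs are unconditional — A243 is the tree theorem
`Fisher2012.thm132rev_threeCongruent_dualHessePencil_holds`, inside the certificate file or fed here) and `(hrank)` ↦ the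
bsd-rank2-observatory kernel certificate of the partner (per-curve `KernelCerts<f>.C<E′>.two_le_rank` or the
walker list `two_le_mordellWeilRank_of_mem_kernelCertRowsW<f>`), BY NAME.

| row | partner | kind | θ certificate | rank certificate |
|---|---|---|---|---|
| 35217b1 | 35217a1 | (M) | dual | percurve |
| 37152e1 | 12384e1 | (G) | dual | percurve |
| 37440fm1 | 37440fl1 | (M) | direct | percurve |
| 38025bb1 | 38025bp1 | (M) | dual | percurve |

Binders left per row: the named facts of the (M)/(G) chain, `hr : r_an = 0`, `hq/hv : ord₃ #Ш_an ≤ 2`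
(+ `D/hc` on (G) rows). References: [CremonaMazur2000] §3; [Fisher2012Hessian] Thm. 13.2 / §13;
[CremonaAlgorithms1997] §3.5; [SilvermanAEC2009] VIII.6.7.
-/

set_option autoImplicit false

noncomputable section

open scoped Classical NumberField
open IsDedekindDomain NumberField WeierstrassCurve Rat.HeightOneSpectrum
  Literature.NumberTheory.EllipticCurves Literature.NumberTheory.EllipticCurves.ModularForms
  Literature.NumberTheory.EllipticCurves.Rank1Residual
  Literature.NumberTheory.EllipticCurves.Rank1Residual.Typed
  Literature.NumberTheory.EllipticCurves.Fisher2012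
  Literature.NumberTheory.GaloisRepresentations
  Summit.BirchSwinnertonDyer.BirchSwinnertonDyer.Rank1Residual.IntModel
  Summit.BirchSwinnertonDyer.BirchSwinnertonDyer.Rank1Residual.X11RankOne
  Summit.BirchSwinnertonDyer.BirchSwinnertonDyer.Rank2Observatory.Tam
  Summit.BirchSwinnertonDyer.BirchSwinnertonDyer.Rank2Observatory
  Summit.BirchSwinnertonDyer.Rank1Residual.GaloisImage

namespace Summit.BirchSwinnertonDyer.Rank1Residual.Additive

/-- **T-VIS3 row `35217b1` ((M); partner `35217a1`, DUAL certificate — A243 by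
`thm132rev_threeCongruent_dualHessePencil_holds`) with θ/hθ AND hrank DISCHARGED** — p18-lineage
shape `bsdp3_vis_v35217b1` fed with `VisCerts.torsionIso3_35217a1_35217b1_of_integralModelInt` and
the bsdr2 kernel certificate `KernelCertsT227.C35217a1.two_le_rank`. BINDERS LEFT = {named facts,
hr, hq/hv}; closes nothing beyond them; nothing booked; census count unchanged.
[cite: CremonaMazur2000, §3 and Table 1] [cite: Fisher2012Hessian, §13 (analogue of Thm. 13.2 for X_E^-(3))] -/
theorem bsdp3_visHesse_v35217b1
    (hKatoS : Kato2004.rankZero_padicValNat_sha_le_sub_localTamagawa_of_additive_potGood_of_imageContainsSL2)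
    (hDel : Delbourgo1998.prop4_rankZero_pow_dvd_constantCoeff)
    (hGZK : rank_eq_analyticRank_of_analyticRank_le_one) (hmod : hasEntireLFunction_rat)
    (hmodD : nonempty_modularParametrizationData)
    (hKatoχ : Wuthrich2014.kato_halfEigenCharIdeal_dvd_cyclotomicPrime_of_surjective)
    (hCT : exists_casselsTate_pairing (K := ℚ))
    (W : WeierstrassCurve ℚ) [W.IsElliptic] [W.IsGloballyMinimal]
    (hI : integralModelInt W = ⟨1, -1, 1, -20948288, -36898535406⟩)
    (hr : W.analyticRank = 0)
    {q : ℚ} (hq : shaAn W = (q : ℂ)) (hv : padicValRat 3 q ≤ 2) :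
    haveI : Fact (Nat.Prime 3) := ⟨Nat.prime_three⟩
    BSDp W 3 := by
  haveI : (⟨1, -1, 1, 229, 1986⟩ : WeierstrassCurve ℚ).IsElliptic :=
    ⟨by rw [isUnit_iff_ne_zero]
        norm_num [WeierstrassCurve.Δ, WeierstrassCurve.b₂, WeierstrassCurve.b₄, WeierstrassCurve.b₆,
          WeierstrassCurve.b₈]⟩
  obtain ⟨θ, hθ⟩ := VisCerts.torsionIso3_35217a1_35217b1_of_integralModelInt W hI ⟨1, -1, 1, 229, 1986⟩ rfl
  have hE' : (⟨1, -1, 1, 229, 1986⟩ : WeierstrassCurve ℤ).map (Int.castRingHom ℚ) =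
      (⟨1, -1, 1, 229, 1986⟩ : WeierstrassCurve ℚ) := by
    ext <;> simp [WeierstrassCurve.map]
  have hrank : 2 ≤ (⟨1, -1, 1, 229, 1986⟩ : WeierstrassCurve ℚ).mordellWeilRank := by
    rw [← hE']; exact KernelCertsT227.C35217a1.two_le_rank
  exact bsdp3_vis_v35217b1 hKatoS hDel hGZK hmod hmodD hKatoχ hCT W hI hr hq hv _ rfl θ hθ hrank

/-- **T-VIS3 row `37152e1` ((G); partner `12384e1`, DUAL certificate — A243 by
`thm132rev_threeCongruent_dualHessePencil_holds`) with θ/hθ AND hrank DISCHARGED** — p18-lineage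
shape `bsdp3_vis_v37152e1` fed with `VisCerts.torsionIso3_12384e1_37152e1_of_integralModelInt` and
the bsdr2 kernel certificate `KernelCerts245.C12384e1.two_le_rank`. BINDERS LEFT = {named facts, hr,
hq/hv, D/hc}; closes nothing beyond them; nothing booked; census count unchanged.
[cite: CremonaMazur2000, §3 and Table 1] [cite: Fisher2012Hessian, §13 (analogue of Thm. 13.2 for X_E^-(3))] -/
theorem bsdp3_visHesse_v37152e1
    (hKato : Kato2004.rankZero_padicValNat_sha_le_of_additive_potGood_of_imageContainsSL2)
    (hCT : exists_casselsTate_pairing (K := ℚ))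
    (hGZK : rank_eq_analyticRank_of_analyticRank_le_one) (hmod : hasEntireLFunction_rat)
    (W : WeierstrassCurve ℚ) [W.IsElliptic] [W.IsGloballyMinimal]
    (hI : integralModelInt W = ⟨0, 0, 0, -1154664, -480686512⟩)
    (hr : W.analyticRank = 0)
    {N : ℕ} [NeZero N] (D : ModularParametrizationData W N) (hc : ¬ ((3 : ℕ) : ℤ) ∣ D.maninConstant)
    {q : ℚ} (hq : shaAn W = (q : ℂ)) (hv : padicValRat 3 q ≤ 2) :
    haveI : Fact (Nat.Prime 3) := ⟨Nat.prime_three⟩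
    BSDp W 3 := by
  haveI : (⟨0, 0, 0, -588, 6176⟩ : WeierstrassCurve ℚ).IsElliptic :=
    ⟨by rw [isUnit_iff_ne_zero]
        norm_num [WeierstrassCurve.Δ, WeierstrassCurve.b₂, WeierstrassCurve.b₄, WeierstrassCurve.b₆,
          WeierstrassCurve.b₈]⟩
  obtain ⟨θ, hθ⟩ := VisCerts.torsionIso3_12384e1_37152e1_of_integralModelInt W hI ⟨0, 0, 0, -588, 6176⟩ rfl
  have hE' : (⟨0, 0, 0, -588, 6176⟩ : WeierstrassCurve ℤ).map (Int.castRingHom ℚ) =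
      (⟨0, 0, 0, -588, 6176⟩ : WeierstrassCurve ℚ) := by
    ext <;> simp [WeierstrassCurve.map]
  have hrank : 2 ≤ (⟨0, 0, 0, -588, 6176⟩ : WeierstrassCurve ℚ).mordellWeilRank := by
    rw [← hE']; exact KernelCerts245.C12384e1.two_le_rank
  exact bsdp3_vis_v37152e1 hKato hCT hGZK hmod W hI hr D hc hq hv _ rfl θ hθ hrank

/-- **T-VIS3 row `37440fm1` ((M); partner `37440fl1`, DIRECT certificate) with θ/hθ AND hrank
DISCHARGED** — p18-lineage shape `bsdp3_vis_v37440fm1` fed with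
`VisCerts.torsionIso3_37440fl1_37440fm1_of_integralModelInt` and the bsdr2 kernel certificate
`KernelCertsF92.C37440fl1.two_le_rank`. BINDERS LEFT = {named facts, hr, hq/hv}; closes nothing
beyond them; nothing booked; census count unchanged.
[cite: CremonaMazur2000, §3 and Table 1] [cite: Fisher2012Hessian, Thm. 13.2 (n = 3)] -/
theorem bsdp3_visHesse_v37440fm1
    (hKatoS : Kato2004.rankZero_padicValNat_sha_le_sub_localTamagawa_of_additive_potGood_of_imageContainsSL2)
    (hDel : Delbourgo1998.prop4_rankZero_pow_dvd_constantCoeff)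
    (hGZK : rank_eq_analyticRank_of_analyticRank_le_one) (hmod : hasEntireLFunction_rat)
    (hmodD : nonempty_modularParametrizationData)
    (hKatoχ : Wuthrich2014.kato_halfEigenCharIdeal_dvd_cyclotomicPrime_of_surjective)
    (hCT : exists_casselsTate_pairing (K := ℚ))
    (W : WeierstrassCurve ℚ) [W.IsElliptic] [W.IsGloballyMinimal]
    (hI : integralModelInt W = ⟨0, 0, 0, -12432, -533536⟩)
    (hr : W.analyticRank = 0)
    {q : ℚ} (hq : shaAn W = (q : ℂ)) (hv : padicValRat 3 q ≤ 2) :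
    haveI : Fact (Nat.Prime 3) := ⟨Nat.prime_three⟩
    BSDp W 3 := by
  haveI : (⟨0, 0, 0, -732, 27056⟩ : WeierstrassCurve ℚ).IsElliptic :=
    ⟨by rw [isUnit_iff_ne_zero]
        norm_num [WeierstrassCurve.Δ, WeierstrassCurve.b₂, WeierstrassCurve.b₄, WeierstrassCurve.b₆,
          WeierstrassCurve.b₈]⟩
  obtain ⟨θ, hθ⟩ := VisCerts.torsionIso3_37440fl1_37440fm1_of_integralModelInt W hI ⟨0, 0, 0, -732, 27056⟩ rfl
  have hE' : (⟨0, 0, 0, -732, 27056⟩ : WeierstrassCurve ℤ).map (Int.castRingHom ℚ) =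
      (⟨0, 0, 0, -732, 27056⟩ : WeierstrassCurve ℚ) := by
    ext <;> simp [WeierstrassCurve.map]
  have hrank : 2 ≤ (⟨0, 0, 0, -732, 27056⟩ : WeierstrassCurve ℚ).mordellWeilRank := by
    rw [← hE']; exact KernelCertsF92.C37440fl1.two_le_rank
  exact bsdp3_vis_v37440fm1 hKatoS hDel hGZK hmod hmodD hKatoχ hCT W hI hr hq hv _ rfl θ hθ hrank

/-- **T-VIS3 row `38025bb1` ((M); partner `38025bp1`, DUAL certificate — A243 by
`thm132rev_threeCongruent_dualHessePencil_holds`) with θ/hθ AND hrank DISCHARGED** — p18-lineage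
shape `bsdp3_vis_v38025bb1` fed with `VisCerts.torsionIso3_38025bp1_38025bb1_of_integralModelInt`
and the bsdr2 kernel certificate `KernelCerts1070.C38025bp1.two_le_rank`. BINDERS LEFT = {named
facts, hr, hq/hv}; closes nothing beyond them; nothing booked; census count unchanged.
[cite: CremonaMazur2000, §3 and Table 1] [cite: Fisher2012Hessian, §13 (analogue of Thm. 13.2 for X_E^-(3))] -/
theorem bsdp3_visHesse_v38025bb1
    (hKatoS : Kato2004.rankZero_padicValNat_sha_le_sub_localTamagawa_of_additive_potGood_of_imageContainsSL2)
    (hDel : Delbourgo1998.prop4_rankZero_pow_dvd_constantCoeff)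
    (hGZK : rank_eq_analyticRank_of_analyticRank_le_one) (hmod : hasEntireLFunction_rat)
    (hmodD : nonempty_modularParametrizationData)
    (hKatoχ : Wuthrich2014.kato_halfEigenCharIdeal_dvd_cyclotomicPrime_of_surjective)
    (hCT : exists_casselsTate_pairing (K := ℚ))
    (W : WeierstrassCurve ℚ) [W.IsElliptic] [W.IsGloballyMinimal]
    (hI : integralModelInt W = ⟨1, -1, 0, -4183542, -3292403009⟩)
    (hr : W.analyticRank = 0)
    {q : ℚ} (hq : shaAn W = (q : ℂ)) (hv : padicValRat 3 q ≤ 2) :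
    haveI : Fact (Nat.Prime 3) := ⟨Nat.prime_three⟩
    BSDp W 3 := by
  haveI : (⟨0, 0, 1, 195, 796⟩ : WeierstrassCurve ℚ).IsElliptic :=
    ⟨by rw [isUnit_iff_ne_zero]
        norm_num [WeierstrassCurve.Δ, WeierstrassCurve.b₂, WeierstrassCurve.b₄, WeierstrassCurve.b₆,
          WeierstrassCurve.b₈]⟩
  obtain ⟨θ, hθ⟩ := VisCerts.torsionIso3_38025bp1_38025bb1_of_integralModelInt W hI ⟨0, 0, 1, 195, 796⟩ rfl
  have hE' : (⟨0, 0, 1, 195, 796⟩ : WeierstrassCurve ℤ).map (Int.castRingHom ℚ) =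
      (⟨0, 0, 1, 195, 796⟩ : WeierstrassCurve ℚ) := by
    ext <;> simp [WeierstrassCurve.map]
  have hrank : 2 ≤ (⟨0, 0, 1, 195, 796⟩ : WeierstrassCurve ℚ).mordellWeilRank := by
    rw [← hE']; exact KernelCerts1070.C38025bp1.two_le_rank
  exact bsdp3_vis_v38025bb1 hKatoS hDel hGZK hmod hmodD hKatoχ hCT W hI hr hq hv _ rfl θ hθ hrank

end Summit.BirchSwinnertonDyer.Rank1Residual.Additive

end
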